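import Mathlib.InformationTheory.KullbackLeibler.Basic
import Mathlib.Probability.ConditionalProbability
import HarnessLib

/-!
# The entropy method needs a speed-budget large-deviation bound (the conditioning witness)

Topic `Literature/Probability/Entropy`; companion of `Literature.Probability.Entropy.DonskerVaradhanTransfer`
(the transfer arithmetic) and `Literature.Probability.Entropy.EntropyInequality` (the entropy inequality).

The relative entropy method controls a non-equilibrium law `μ` only through a budget `H(μ ‖ ν) ≤ K`
against an invariant reference law `ν` and the entropy inequality
`∫ B dμ ≤ λ⁻¹ (H(μ ‖ ν) + log ∫ e^{λ B} dν)` (Kipnis–Landim 1999, Appendix 1 §8). That inequality is SHARP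
in the following elementary sense (the trivial half of the Donsker–Varadhan duality): the reference law
CONDITIONED on an event `A` is a probability measure, gives `A` full mass, and has entropy exactly
`−log ν(A)` (`toReal_klDiv_cond`). Consequently:

* `exists_klDiv_le_and_apply_eq_one`: if `ν(A) ≥ e^{−K}` there is a probability measure `μ ≪ ν` with
  `H(μ ‖ ν) ≤ K` and `μ(A) = 1`;
* `measureReal_lt_exp_neg_of_forall_klDiv_le` (contrapositive): an argument that forces `μ(A) < 1`
  for EVERY law of entropy `≤ K` must have `ν(A) < e^{−K}`.

With the budget `K(N+1)` of the hydrodynamic-limit setting (`K` = entropy per particle of local Gibbs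
data, a fixed number) this says: every "bad" event the method is asked to exclude must have probability
below `e^{−K(N+1)}` under the INVARIANT law — a large-deviation upper bound at the speed of the budget;
in-probability, Cesàro, Chebyshev-level or rate-free ergodic inputs under the invariant law cannot feed
the method. (Recorded for the crux `InformationPercolationEngine.PercolationClosesChaos` of
`AtomisticToContinuum/HydrodynamicLimit`, whose lines `ergodic-window-is-von-neumann` and
`impact-disc-flattening` proposed rate-free equilibrium inputs; see
`Summits/AtomisticToContinuum/HydrodynamicLimit/Cruxes/PercolationClosesChaos/Lines/Sketch.dead.md`.)

Also here, as lemmas: `llr_restrict_ae_eq_zero` (`d(ν|_A)/dν = 𝟙_A` has zero log-likelihood ratio a.e.),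
`toReal_klDiv_restrict` (`H(ν|_A ‖ ν) = 1 − ν(A)` in Mathlib's convention for sub-probability measures),
`cond_eq_nnreal_smul_restrict`, `klDiv_cond_ne_top`.

Sources: C. Kipnis, C. Landim, *Scaling Limits of Interacting Particle Systems* (1999), Appendix 1 §8
(entropy inequality and its variational form); M. D. Donsker, S. R. S. Varadhan, Comm. Pure Appl. Math.
28 (1975) (the variational formula). Every statement is an elementary consequence and is tagged `[folklore]`.
-/

noncomputable section

namespace Literature.Probability.Entropy

open _root_.MeasureTheory _root_.ProbabilityTheory InformationTheory
open scoped ENNReal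

variable {Ω : Type*} [MeasurableSpace Ω]

/-- The log-likelihood ratio of a restriction is a.e. zero: `d(ν|_A)/dν = 𝟙_A`, and `log 1 = log 0 = 0`. [folklore] -/
theorem llr_restrict_ae_eq_zero (ν : Measure Ω) [SigmaFinite ν] {A : Set Ω} (hA : MeasurableSet A) :
    llr (ν.restrict A) ν =ᵐ[ν] 0 := by
  filter_upwards [Measure.rnDeriv_restrict_self ν hA] with x hx
  simp only [llr, hx, Pi.zero_apply]
  by_cases h : x ∈ A <;> simp [Set.indicator, h]

/-- `H(ν|_A ‖ ν) = 1 − ν(A)` (in `toReal` form) for a probability measure `ν`. [folklore] -/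
theorem toReal_klDiv_restrict (ν : Measure Ω) [IsProbabilityMeasure ν] {A : Set Ω} (hA : MeasurableSet A) :
    (klDiv (ν.restrict A) ν).toReal = 1 - ν.real A := by
  have hac : ν.restrict A ≪ ν := Measure.absolutelyContinuous_of_le Measure.restrict_le_self
  have h0 : llr (ν.restrict A) ν =ᵐ[ν.restrict A] 0 :=
    ae_restrict_of_ae (llr_restrict_ae_eq_zero ν hA)
  have hint : Integrable (llr (ν.restrict A) ν) (ν.restrict A) := (integrable_congr h0).mpr (integrable_zero _ _ _)
  rw [toReal_klDiv hac hint, integral_congr_ae h0]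
  simp only [Pi.zero_apply, integral_zero, zero_add, measureReal_restrict_apply_univ, probReal_univ]

/-- The conditioned law as an `ℝ≥0`-multiple of the restriction: `ν(·|A) = (ν A)⁻¹ • ν|_A`. [folklore] -/
theorem cond_eq_nnreal_smul_restrict (ν : Measure Ω) [IsFiniteMeasure ν] {A : Set Ω} (hA0 : ν A ≠ 0) :
    ν[|A] = ((ν A).toNNReal)⁻¹ • ν.restrict A := by
  rw [ProbabilityTheory.cond, ENNReal.smul_def,
    ENNReal.coe_inv (by simp [ENNReal.toNNReal_eq_zero_iff, hA0, measure_ne_top ν A]),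
    ENNReal.coe_toNNReal (measure_ne_top ν A)]

/-- `H(ν(·|A) ‖ ν) < ∞`. [folklore] -/
theorem klDiv_cond_ne_top (ν : Measure Ω) [IsProbabilityMeasure ν] {A : Set Ω} (hA : MeasurableSet A)
    (hA0 : ν A ≠ 0) : klDiv (ν[|A]) ν ≠ ⊤ := by
  have hac : ν.restrict A ≪ ν := Measure.absolutelyContinuous_of_le Measure.restrict_le_self
  have h0 : llr (ν.restrict A) ν =ᵐ[ν.restrict A] 0 :=
    ae_restrict_of_ae (llr_restrict_ae_eq_zero ν hA)
  set c : NNReal := ((ν A).toNNReal)⁻¹ with hc_def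
  have hc0 : c ≠ 0 := by
    simp only [hc_def, ne_eq, inv_eq_zero, ENNReal.toNNReal_eq_zero_iff, hA0, measure_ne_top, or_self,
      not_false_eq_true]
  rw [cond_eq_nnreal_smul_restrict ν hA0]
  refine klDiv_ne_top (hac.smul_left c) ?_
  refine Integrable.smul_measure_nnreal ?_
  have h_llr := llr_smul_nnreal_left hac c (by simpa using hc0)
  rw [integrable_congr h_llr]
  refine (integrable_congr (h0.add (Filter.EventuallyEq.refl _ fun _ => Real.log c))).mpr ?_
  simp

/-- **Entropy of the conditioned law.** For a probability measure `ν` and an event `A` with `ν(A) ≠ 0`: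
`H(ν(· | A) ‖ ν) = −log ν(A)` (in `toReal` form). [folklore] -/
theorem toReal_klDiv_cond (ν : Measure Ω) [IsProbabilityMeasure ν] {A : Set Ω} (hA : MeasurableSet A)
    (hA0 : ν A ≠ 0) : (klDiv (ν[|A]) ν).toReal = -Real.log (ν.real A) := by
  have hac : ν.restrict A ≪ ν := Measure.absolutelyContinuous_of_le Measure.restrict_le_self
  have h0 : llr (ν.restrict A) ν =ᵐ[ν.restrict A] 0 :=
    ae_restrict_of_ae (llr_restrict_ae_eq_zero ν hA)
  have hint : Integrable (llr (ν.restrict A) ν) (ν.restrict A) := (integrable_congr h0).mpr (integrable_zero _ _ _)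
  have hq : 0 < ν.real A := by
    rw [measureReal_def]; exact ENNReal.toReal_pos hA0 (measure_ne_top ν A)
  set c : NNReal := ((ν A).toNNReal)⁻¹ with hc_def
  have hcq : (c : ℝ) = (ν.real A)⁻¹ := by
    rw [hc_def, NNReal.coe_inv, ENNReal.coe_toNNReal_eq_toReal, measureReal_def]
  rw [cond_eq_nnreal_smul_restrict ν hA0, toReal_klDiv_smul_left hac hint c, toReal_klDiv_restrict ν hA,
    measureReal_restrict_apply_univ, probReal_univ, hcq, Real.log_inv]
  field_simp
  ring

/-- **Necessity of a large-deviation bound for the entropy method** (Donsker–Varadhan duality, by conditioning). If an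
event `A` has reference probability at least `e^{−K}`, then there is a probability measure of entropy at most `K`
relative to the reference — the reference conditioned on `A` — which gives `A` full mass. Hence any argument that
bounds `μ(A)` away from `1` using ONLY `H(μ ‖ ν) ≤ K` must in fact have `ν(A) < e^{−K}`. [folklore] -/
theorem exists_klDiv_le_and_apply_eq_one (ν : Measure Ω) [IsProbabilityMeasure ν] {A : Set Ω} (hA : MeasurableSet A)
    {K : ℝ} (hK : Real.exp (-K) ≤ ν.real A) :
    ∃ μ : Measure Ω, IsProbabilityMeasure μ ∧ μ ≪ ν ∧ klDiv μ ν ≤ ENNReal.ofReal K ∧ μ A = 1 := by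
  have hq : 0 < ν.real A := lt_of_lt_of_le (Real.exp_pos _) hK
  have hA0 : ν A ≠ 0 := by
    intro h; simp [measureReal_def, h] at hq
  refine ⟨ν[|A], cond_isProbabilityMeasure hA0, cond_absolutelyContinuous, ?_, ?_⟩
  · rw [ENNReal.le_ofReal_iff_toReal_le (klDiv_cond_ne_top ν hA hA0), toReal_klDiv_cond ν hA hA0]
    · have := Real.log_le_log (Real.exp_pos _) hK
      rw [Real.log_exp] at this
      linarith
    · have := Real.log_le_log (Real.exp_pos _) hK
      rw [Real.log_exp] at this
      have hle : Real.log (ν.real A) ≤ 0 := Real.log_nonpos hq.le measureReal_le_one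
      linarith
  · exact cond_apply_self hA0 (measure_ne_top ν A)

/-- **The entropy method needs speed-budget large deviations** (contrapositive of
`exists_klDiv_le_and_apply_eq_one`): if every probability measure `μ ≪ ν` with `H(μ ‖ ν) ≤ K` satisfies
`μ(A) < 1`, then `ν(A) < e^{−K}`. [folklore] -/
theorem measureReal_lt_exp_neg_of_forall_klDiv_le (ν : Measure Ω) [IsProbabilityMeasure ν] {A : Set Ω}
    (hA : MeasurableSet A) {K : ℝ}
    (h : ∀ μ : Measure Ω, IsProbabilityMeasure μ → μ ≪ ν → klDiv μ ν ≤ ENNReal.ofReal K → μ A < 1) :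
    ν.real A < Real.exp (-K) := by
  by_contra hK
  have hK := not_lt.mp hK
  obtain ⟨μ, hμ, hac, hkl, hμA⟩ := exists_klDiv_le_and_apply_eq_one ν hA hK
  exact (h μ hμ hac hkl).ne hμA

end Literature.Probability.Entropy

end
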